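import Summits.BirchSwinnertonDyer.Rank1Residual.X4.CharacterTwistDepletion
import Summits.BirchSwinnertonDyer.Rank1Residual.X4.HeckeTransformCommute
import Mathlib.FieldTheory.Finite.Basic
import HarnessLib

/-!
# Level lowering kills Kurihara numbers mod `p`, part 4g: the depletion recursion `S = λ·S∘[p] + T` — uniqueness, the closed form on `p`-periodic points, the `ℓ`-old sign `w ↦ w·χ(ℓ)`, Hecke relations through the recursion, and the transport of an `ℓ`-old congruence WITH ITS DEFECT (cell `b2b-bsdres`, seat additive-p4, line V82)

HONEST FRAMING (verbatim, cell `b2b-bsdres`): the goal of the cell is to DELETE the COMBINATION-SHAPED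
residual classes for ALL analytic-rank `≤ 1` curves over `ℚ` — "full BSD formula for every rank `≤ 1`
curve in class `C`" assembled STRICTLY from published theorems — so that the rank-`≤ 1` remainder
becomes exactly the CONSTRUCTION-SHAPED classes, which are TYPED (missing-input Props), NOT attempted;
this is not "finishing BSD". This file: research-route KERNEL THEOREMS (finite sums and `1`-periodic
functions `ℚ → R` over a commutative ring; no named fact, no conjecture, no definition, nothing booked;
class X4 stays CONSTRUCTION-SHAPED).

## What is proved

Part 4f isolated the DEPLETION IDENTITY of a principal-series row (`f_W = g ⊗ χ̄`, `χ` of conductor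
`p`, `f_W ⊗ χ = g − a_p(g)·g(p·)`): the source symbol `S` and the twisted symbol `T = c·T_{χ⁻¹}μ_W`
satisfy `S(x) = λ·S(px) + T(x)`, `λ = a_p(g)/p`. This file is the algebra OF THAT RECURSION for
any commutative ring `R`, `λ ∈ R` with every `1 − λⁿ` (`n ≥ 1`) a unit (in a field: `λ` no root of
unity, e.g. `|λ| = p^{-1/2}`), and `1`-periodic functions `ℚ → R`:
* §1 **`eq_zero_of_homogeneous`** / **`depletion_unique`** — `h = λ·h∘[p]` has ONLY the zero
  periodic solution (every rational is `p`-PERIODIC after clearing the `p`-part of its denominator,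
  `exists_pow_mul_periodic`, by Euler's theorem; on a `p`-periodic point `(1 − λⁿ)h(y) = 0`), so the
  recursion has at most one periodic solution: the `Γ₁` source symbol of a principal-series row is
  DETERMINED by `W`'s own symbol (memo V80 §3).
* §2 **`one_sub_pow_mul_apply_eq_sum`** — the CLOSED FORM `(1 − λⁿ)S(y) = ∑_{i<n} λⁱT(pⁱy)` on a
  `p`-periodic point (the formula of the seat's exact instrument E22); **`depletion_mem_ideal`** —
  values of `T` in an ideal `I` ⇒ values of `S` in `I`.
* §3 **`depletion_oldform`** / **`depletion_solution_oldform`** — THE `ℓ`-OLD SIGN THROUGH THE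
  RECURSION IS `w ↦ w·χ(ℓ)`: `D = μ − w·μ∘[ℓ]` ⇒ the solution for `D` is `M − (wχ(ℓ))·M∘[ℓ]`
  (`M` the solution for `μ`) — part 4b's source-side sign `hw : w = χ ℓ` read off the `W`-side
  sign `w = 1`.
* §4 **`depletion_heckeRel_nebentypus`** — HECKE RELATIONS PASS THROUGH THE RECURSION with the
  twisted nebentypus: `μ` `T_q`-eigen (`q ≠ p`) with nebentypus value `ε`, eigenvalue `a` ⇒ `M` is
  `T_q`-eigen with `ε·χ(q)²`, `a·χ(q)` (from the `W`-side, `ε = 1`: character `χ² = ψ` and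
  `a_q(g) = χ(q)a_q(W)`, Shimura 1971 Prop. 3.64); at a Kolyvagin prime of `(W, p)` nothing is
  visible (`depletion_heckeRel_conductor`).
* §5 **`depletion_transport_defect`** — an `ℓ`-old CONGRUENCE moves WITH ITS DEFECT:
  `Λ = μ − w·μ∘[ℓ] + π·D′` ⇒ `S_Λ = M − (wχ(ℓ))·M∘[ℓ] + π·S′` EXACTLY.

READING OF §5 — the honest status of the successor task "depletion transport of the certificate"
(V81-PLAN §C.2 expected pure algebra): the `W`-side certificate `Λ ≡ μ − μ∘[ℓ] (mod p)` moves to the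
source side EXACTLY for the NON-PRIMITIVE source symbol `S_Λ`, whose value module on the cell's
principal-series row is `α·O`, `v_𝔭(α) = v_𝔭(p) = 1` (E22: `α = 7/2`, `(1, 1)`); part 4b's template
consumes the PRIMITIVE symbol `S_Λ/α` mod `𝔭`, where `(p/α)·S′` is a `𝔭`-UNIT times `S′`, so it
needs the EXTRA divisibility `S′ ≡ 0 (mod 𝔭)` that §2 does not give — the one-power-of-`𝔭`
phenomenon of E22's `T`-module `(a₇/2)`. `W ⟹ source` is formal ONLY UP TO ONE POWER OF `𝔭`;
`source ⟹ W` (parts 4b/4e/4f) is the formal direction the display uses. Nothing is booked.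

## References

* G. Shimura, *Introduction to the arithmetic theory of automorphic functions* (1971), Thm. 3.24,
  Prop. 3.64. [cite: Shimura1971, Prop. 3.64]
* B. Mazur, J. Tate, J. Teitelbaum, Invent. Math. 84 (1986), §I.4 (4.2), §I.8.
  [cite: MazurTateTeitelbaum1986Invent, §I.4 (4.2) and §I.8]
* K. Ireland, M. Rosen, GTM 84, §8.3. [cite: IrelandRosen1990, §8.3]
-/

noncomputable section

open Finset

open Summit.BirchSwinnertonDyer.Rank1Residual.LevelLowering Literature.NumberTheory.EllipticCurves

namespace Summit.BirchSwinnertonDyer.Rank1Residual.NebentypusTwist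

variable {p : ℕ} [hp : Fact p.Prime] {R : Type*} [CommRing R]

/-! ### §1 The homogeneous recursion has only the zero periodic solution; uniqueness -/

section Homogeneous

variable {h : ℚ → R} {lam : R}

omit hp in
/-- Iterating the homogeneous recursion: `h(x) = λⁿ·h(pⁿx)`. [folklore] -/
theorem eq_pow_mul_apply_pow_mul (hrec : ∀ x : ℚ, h x = lam * h (p * x)) (n : ℕ) (x : ℚ) :
    h x = lam ^ n * h ((p : ℚ) ^ n * x) := by
  induction n generalizing x with
  | zero => simp
  | succ n ih =>
    rw [ih x, hrec ((p : ℚ) ^ n * x), pow_succ lam n, pow_succ (p : ℚ) n, mul_assoc,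
      show (p : ℚ) * ((p : ℚ) ^ n * x) = (p : ℚ) ^ n * p * x by ring]

omit hp in
/-- **On a `p`-periodic point the recursion closes up**: `pⁿy = y + z` (`z ∈ ℤ`), `h` periodic with
`h = λ·h∘[p]` ⇒ `(1 − λⁿ)·h(y) = 0`. [folklore] -/
theorem one_sub_pow_mul_apply_eq_zero (hh : IsPeriodic h) (hrec : ∀ x : ℚ, h x = lam * h (p * x))
    {y : ℚ} {n : ℕ} {z : ℤ} (hy : (p : ℚ) ^ n * y = y + z) : (1 - lam ^ n) * h y = 0 := by
  have h1 := eq_pow_mul_apply_pow_mul hrec n y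
  rw [hh.eq_of_eq_add_int z hy] at h1
  linear_combination h1

/-- **Every rational becomes `p`-periodic after clearing the `p`-part of its denominator**:
`x = a/(pᵉb)`, `p ∤ b` ⇒ `pᵉx = a/b` and `p^{φ(b)}·(a/b) ≡ a/b (mod ℤ)` (Euler). [cite: IrelandRosen1990, §8.3] -/
theorem exists_pow_mul_periodic (x : ℚ) :
    ∃ e n : ℕ, 0 < n ∧ ∃ z : ℤ, (p : ℚ) ^ n * ((p : ℚ) ^ e * x) = (p : ℚ) ^ e * x + z := by
  obtain ⟨e, b, hb, hden⟩ := Nat.exists_eq_pow_mul_and_not_dvd x.den_ne_zero p hp.out.one_lt.ne'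
  have hb0 : b ≠ 0 := by
    rintro rfl
    simp at hden
  have hbQ : (b : ℚ) ≠ 0 := by exact_mod_cast hb0
  -- `pᵉ x = num / b`
  have hy : (p : ℚ) ^ e * x = (x.num : ℚ) / b := by
    rw [eq_div_iff hbQ]
    have h1 : x * (x.den : ℚ) = x.num := Rat.mul_den_eq_num x
    have h2 : (x.den : ℚ) = (p : ℚ) ^ e * b := by exact_mod_cast hden
    rw [h2] at h1
    linear_combination h1
  -- Euler: `p^{φ(b)} = 1 - b·k` for an integer `k`
  have hcop : Nat.Coprime p b := (Nat.Prime.coprime_iff_not_dvd hp.out).mpr hb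
  obtain ⟨k, hk⟩ := (Nat.ModEq.pow_totient hcop).dvd
  have hkQ : (1 : ℚ) - (p : ℚ) ^ b.totient = (b : ℚ) * k := by
    have : ((1 : ℕ) : ℤ) - ((p ^ b.totient : ℕ) : ℤ) = (b : ℤ) * k := hk
    push_cast at this
    exact_mod_cast this
  refine ⟨e, b.totient, Nat.totient_pos.mpr (Nat.pos_of_ne_zero hb0), -(k * x.num), ?_⟩
  rw [hy, show (p : ℚ) ^ b.totient = 1 - (b : ℚ) * k by linear_combination -hkQ]
  push_cast
  field_simp
  ring

/-- **THE HOMOGENEOUS DEPLETION RECURSION HAS ONLY THE ZERO PERIODIC SOLUTION**: `h` periodic,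
`h(x) = λ·h(px)` for all `x`, every `1 − λⁿ` (`n ≥ 1`) a unit ⇒ `h = 0` (`h(x) = λᵉ·h(pᵉx)` with
`pᵉx` `p`-periodic, where `(1 − λⁿ)h = 0`). [cite: MazurTateTeitelbaum1986Invent, §I.8] -/
theorem eq_zero_of_homogeneous (hh : IsPeriodic h) (hrec : ∀ x : ℚ, h x = lam * h (p * x))
    (hlam : ∀ n : ℕ, 0 < n → IsUnit (1 - lam ^ n)) (x : ℚ) : h x = 0 := by
  obtain ⟨e, n, hn, z, hz⟩ := exists_pow_mul_periodic (p := p) x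
  have hy : h ((p : ℚ) ^ e * x) = 0 :=
    (hlam n hn).mul_right_eq_zero.mp (one_sub_pow_mul_apply_eq_zero hh hrec hz)
  rw [eq_pow_mul_apply_pow_mul hrec e x, hy, mul_zero]

/-- **UNIQUENESS OF THE DEPLETION RECURSION**: two periodic solutions of `S = λ·S∘[p] + T`
coincide — the `Γ₁` source symbol of a principal-series row is DETERMINED by the twisted symbol of
`W` and `λ = a_p(g)/p`. [cite: MazurTateTeitelbaum1986Invent, §I.8] -/
theorem depletion_unique {S₁ S₂ T : ℚ → R} (h₁ : IsPeriodic S₁) (h₂ : IsPeriodic S₂)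
    (hrec₁ : ∀ x : ℚ, S₁ x = lam * S₁ (p * x) + T x)
    (hrec₂ : ∀ x : ℚ, S₂ x = lam * S₂ (p * x) + T x)
    (hlam : ∀ n : ℕ, 0 < n → IsUnit (1 - lam ^ n)) : S₁ = S₂ := by
  funext x
  have hper : IsPeriodic (fun x ↦ S₁ x - S₂ x) := fun r z ↦ by
    show S₁ (r + z) - S₂ (r + z) = S₁ r - S₂ r
    rw [h₁, h₂]
  have h0 := eq_zero_of_homogeneous (p := p) hper
    (fun x ↦ by
      show S₁ x - S₂ x = lam * (S₁ (p * x) - S₂ (p * x))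
      rw [hrec₁ x, hrec₂ x]
      ring) hlam x
  exact sub_eq_zero.mp h0

end Homogeneous

/-! ### §2 The closed form on a `p`-periodic point; the recursion preserves ideals -/

section ClosedForm

variable {S T : ℚ → R} {lam : R}

omit hp in
/-- Iterating the inhomogeneous recursion: `S(x) = λⁿS(pⁿx) + ∑_{i<n} λⁱT(pⁱx)`. [folklore] -/
theorem eq_pow_mul_add_sum (hrec : ∀ x : ℚ, S x = lam * S (p * x) + T x) (n : ℕ) (x : ℚ) :
    S x = lam ^ n * S ((p : ℚ) ^ n * x) + ∑ i ∈ Finset.range n, lam ^ i * T ((p : ℚ) ^ i * x) := by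
  induction n with
  | zero => simp
  | succ n ih =>
    rw [ih, hrec ((p : ℚ) ^ n * x), Finset.sum_range_succ, pow_succ lam n, pow_succ (p : ℚ) n,
      show (p : ℚ) * ((p : ℚ) ^ n * x) = (p : ℚ) ^ n * p * x by ring]
    ring

omit hp in
/-- **THE CLOSED FORM ON A `p`-PERIODIC POINT**: `pⁿy = y + z` (`z ∈ ℤ`), `S` a periodic solution
of `S = λ·S∘[p] + T` ⇒ `(1 − λⁿ)·S(y) = ∑_{i<n} λⁱ T(pⁱy)` (instrument E22's formula, memo V80
§3). [cite: MazurTateTeitelbaum1986Invent, §I.8] -/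
theorem one_sub_pow_mul_apply_eq_sum (hS : IsPeriodic S)
    (hrec : ∀ x : ℚ, S x = lam * S (p * x) + T x) {y : ℚ} {n : ℕ} {z : ℤ}
    (hy : (p : ℚ) ^ n * y = y + z) :
    (1 - lam ^ n) * S y = ∑ i ∈ Finset.range n, lam ^ i * T ((p : ℚ) ^ i * y) := by
  have h1 := eq_pow_mul_add_sum hrec n y
  rw [hS.eq_of_eq_add_int z hy] at h1
  linear_combination h1

/-- **THE RECURSION PRESERVES IDEALS**: every `1 − λⁿ` a unit, `T` valued in an ideal `I` ⇒ the
periodic solution `S` is valued in `I` (divisibility is never lowered where `λ` and the `(1 − λⁿ)⁻¹`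
live; it is not raised either — §5's reading). [cite: MazurTateTeitelbaum1986Invent, §I.8] -/
theorem depletion_mem_ideal (hS : IsPeriodic S) (hrec : ∀ x : ℚ, S x = lam * S (p * x) + T x)
    (hlam : ∀ n : ℕ, 0 < n → IsUnit (1 - lam ^ n)) (I : Ideal R) (hT : ∀ x : ℚ, T x ∈ I)
    (x : ℚ) : S x ∈ I := by
  obtain ⟨e, n, hn, z, hz⟩ := exists_pow_mul_periodic (p := p) x
  -- on the periodic point `pᵉ x`
  have hy : S ((p : ℚ) ^ e * x) ∈ I := by
    obtain ⟨u, hu⟩ := hlam n hn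
    have h1 := one_sub_pow_mul_apply_eq_sum hS hrec hz
    have h2 : S ((p : ℚ) ^ e * x) =
        ↑u⁻¹ * ∑ i ∈ Finset.range n, lam ^ i * T ((p : ℚ) ^ i * ((p : ℚ) ^ e * x)) := by
      rw [← h1, ← hu, ← mul_assoc, Units.inv_mul, one_mul]
    rw [h2]
    exact I.mul_mem_left _ (I.sum_mem fun i _ ↦ I.mul_mem_left _ (hT _))
  rw [eq_pow_mul_add_sum hrec e x]
  exact I.add_mem (I.mul_mem_left _ hy) (I.sum_mem fun i _ ↦ I.mul_mem_left _ (hT _))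

end ClosedForm

/-! ### §3 The `ℓ`-old sign through the recursion: `w ↦ w·χ(ℓ)` -/

section Oldform

variable (χ : MulChar (ZMod p) R) {μ D M S : ℚ → R} {lam c w : R} {ℓ : ℕ}

/-- `ℓ` prime to `p` is a unit of `ℤ/p`. [folklore] -/
private theorem isUnit_natCast_of_not_dvd (hℓ : ¬ p ∣ ℓ) : IsUnit ((ℓ : ℕ) : ZMod p) :=
  Ne.isUnit (mt (ZMod.natCast_eq_zero_iff _ _).mp hℓ)

/-- **THE `ℓ`-OLD SIGN THROUGH THE DEPLETION RECURSION IS `w ↦ w·χ(ℓ)`.** If `D = μ − w·μ∘[ℓ]`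
(`μ` periodic, `p ∤ ℓ`) and `M(x) = λ·M(px) + c·∑_v χ⁻¹(v) μ(x + v/p)` for all `x`, then
`S := M − (wχ(ℓ))·M∘[ℓ]` satisfies `S(x) = λ·S(px) + c·∑_v χ⁻¹(v) D(x + v/p)` (the twisted sum of
`D` is `T_{χ⁻¹}μ − (wχ(ℓ))·(T_{χ⁻¹}μ)∘[ℓ]`: part 4b's `twistSum_oldform_of_mul_eq_one` for `χ⁻¹`,
inverse value `χ(ℓ)`). On a principal-series row the `W`-side sign is `w = 1`, so the source-side
sign is `χ(ℓ)` = part 4b's `hw`. [cite: Shimura1971, Prop. 3.64] [cite: MazurTateTeitelbaum1986Invent, §I.8] -/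
theorem depletion_oldform (hμ : IsPeriodic μ) (hℓ : ¬ p ∣ ℓ)
    (hD : ∀ x : ℚ, D x = μ x - w * μ (ℓ * x))
    (hM : ∀ x : ℚ, M x = lam * M (p * x) + c * ∑ v : ZMod p, χ⁻¹ v * μ (x + (v.val : ℚ) / p))
    (x : ℚ) :
    M x - (w * χ ℓ) * M (ℓ * x) =
      lam * (M (p * x) - (w * χ ℓ) * M (ℓ * (p * x))) +
        c * ∑ v : ZMod p, χ⁻¹ v * D (x + (v.val : ℚ) / p) := by
  have hℓu : IsUnit ((ℓ : ℕ) : ZMod p) := isUnit_natCast_of_not_dvd hℓ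
  have hc : χ ℓ * χ⁻¹.toMonoidHom ℓ = 1 := by
    rw [MulChar.coe_toMonoidHom]
    exact apply_mul_inv_apply χ hℓu
  have hT := twistSum_oldform_of_mul_eq_one χ⁻¹.toMonoidHom hμ hℓu hc hD x
  simp only [MulChar.coe_toMonoidHom] at hT
  rw [hT, show (ℓ : ℚ) * (p * x) = p * (ℓ * x) by ring]
  have h1 := hM x
  have h2 := hM (ℓ * x)
  linear_combination h1 - (w * χ ℓ) * h2

omit hp in
/-- `M∘[ℓ]` and `M − κ·M∘[ℓ]` are periodic when `M` is. [folklore] -/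
theorem isPeriodic_sub_mul_comp (hM : IsPeriodic M) (κ : R) (ℓ : ℕ) :
    IsPeriodic (fun x ↦ M x - κ * M (ℓ * x)) := by
  intro r z
  simp only
  rw [hM r z, hM.eq_of_eq_add_int (ℓ * z) (by push_cast; ring : (ℓ : ℚ) * (r + z) = ℓ * r + ((ℓ * z : ℤ) : ℚ))]

/-- **THE source-side `ℓ`-old identity, by uniqueness**: `S` a periodic solution for `D`, `M`
periodic, every `1 − λⁿ` a unit ⇒ `S = M − (wχ(ℓ))·M∘[ℓ]`. [cite: MazurTateTeitelbaum1986Invent, §I.8] -/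
theorem depletion_solution_oldform (hμ : IsPeriodic μ) (hMper : IsPeriodic M) (hS : IsPeriodic S)
    (hℓ : ¬ p ∣ ℓ) (hD : ∀ x : ℚ, D x = μ x - w * μ (ℓ * x))
    (hM : ∀ x : ℚ, M x = lam * M (p * x) + c * ∑ v : ZMod p, χ⁻¹ v * μ (x + (v.val : ℚ) / p))
    (hSrec : ∀ x : ℚ, S x = lam * S (p * x) + c * ∑ v : ZMod p, χ⁻¹ v * D (x + (v.val : ℚ) / p))
    (hlam : ∀ n : ℕ, 0 < n → IsUnit (1 - lam ^ n)) (x : ℚ) :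
    S x = M x - (w * χ ℓ) * M (ℓ * x) := by
  have h := depletion_unique (p := p) hS (isPeriodic_sub_mul_comp hMper (w * χ ℓ) ℓ) hSrec
    (fun x ↦ depletion_oldform χ hμ hℓ hD hM x) hlam
  exact congrFun h x

end Oldform

/-! ### §4 Hecke relations pass through the recursion (with the twisted nebentypus) -/

section Hecke

variable (χ : MulChar (ZMod p) R) {μ M : ℚ → R} {lam c : R}

/-- **HECKE RELATIONS PASS THROUGH THE DEPLETION RECURSION.** `q ≠ p` prime, `μ` periodic and
`T_q`-eigen WITH NEBENTYPUS value `ε` and eigenvalue `a` (`∑_{j<q} μ((s+j)/q) + ε·μ(qs) = a·μ(s)`),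
`M` a periodic solution of `M(x) = λ·M(px) + c·∑_v χ⁻¹(v) μ(x + v/p)`, every `1 − λⁿ` a unit ⇒
`M` is `T_q`-eigen with nebentypus value `ε·χ(q)²` and eigenvalue `a·χ(q)`: the defect
`H(r) = ∑_j M((r+j)/q) + εχ(q)²M(qr) − aχ(q)M(r)` is periodic and solves the HOMOGENEOUS recursion
(part 4b's `twistSum_heckeRel_nebentypus` for `χ⁻¹` with inverse value `χ(q)`; the reindexing
`j ↦ pj mod q` for the `λ`-term), so `H = 0` by §1. (Shimura 1971 Prop. 3.64: the source has
character `χ² = ψ` and `a_q(g) = χ(q)a_q(W)`.)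
[cite: Shimura1971, Prop. 3.64] [cite: MazurTateTeitelbaum1986Invent, §I.4 (4.2) and §I.8] -/
theorem depletion_heckeRel_nebentypus (hμ : IsPeriodic μ) (hMper : IsPeriodic M) {q : ℕ}
    (hq : q.Prime) (hqp : q ≠ p) {ε a : R}
    (hH : ∀ s : ℚ, ∑ j ∈ Finset.range q, μ ((s + j) / q) + ε * μ (q * s) = a * μ s)
    (hM : ∀ x : ℚ, M x = lam * M (p * x) + c * ∑ v : ZMod p, χ⁻¹ v * μ (x + (v.val : ℚ) / p))
    (hlam : ∀ n : ℕ, 0 < n → IsUnit (1 - lam ^ n)) (r : ℚ) :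
    ∑ j ∈ Finset.range q, M ((r + j) / q) + (ε * χ q ^ 2) * M (q * r) = (a * χ q) * M r := by
  -- the inhomogeneity `T = T_{χ⁻¹} μ` and its Hecke relation (part 4b)
  set T : ℚ → R := fun x ↦ ∑ v : ZMod p, χ⁻¹ v * μ (x + (v.val : ℚ) / p) with hTdef
  have hpq : ¬ p ∣ q := fun h ↦ hqp ((Nat.prime_dvd_prime_iff_eq hp.out hq).mp h).symm
  have hqu : IsUnit ((q : ℕ) : ZMod p) := Ne.isUnit (mt (ZMod.natCast_eq_zero_iff _ _).mp hpq)
  have hcq : χ q * χ⁻¹.toMonoidHom q = 1 := by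
    rw [MulChar.coe_toMonoidHom]
    exact apply_mul_inv_apply χ hqu
  have hTH : ∀ s : ℚ, ∑ j ∈ Finset.range q, T ((s + j) / q) + (ε * χ q ^ 2) * T (q * s) =
      (a * χ q) * T s := by
    intro s
    have h := twistSum_heckeRel_nebentypus χ⁻¹.toMonoidHom hμ hq.ne_zero hqu hcq hH s
    simpa only [MulChar.coe_toMonoidHom, hTdef] using h
  have hMT : ∀ x : ℚ, M x = lam * M (p * x) + c * T x := fun x ↦ by rw [hM x]
  -- the defect function `H` is periodic ...
  set H : ℚ → R := fun r ↦
    ∑ j ∈ Finset.range q, M ((r + j) / q) + (ε * χ q ^ 2) * M (q * r) - (a * χ q) * M r with hHdef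
  have hHper : IsPeriodic H := by
    intro r z
    simp only [hHdef]
    rw [sum_range_comp_add_int hMper hq.pos z r, hMper r z,
      hMper.eq_of_eq_add_int (q * z) (by push_cast; ring : (q : ℚ) * (r + z) = q * r + ((q * z : ℤ) : ℚ))]
  -- ... and satisfies the homogeneous recursion
  have hcopr : Nat.Coprime p q := (Nat.coprime_primes hp.out hq).mpr (Ne.symm hqp)
  have hHrec : ∀ r : ℚ, H r = lam * H (p * r) := by
    intro r
    simp only [hHdef]
    have hsum : ∑ j ∈ Finset.range q, M ((r + j) / q) =
        lam * ∑ j ∈ Finset.range q, M ((p * r + j) / q) +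
          c * ∑ j ∈ Finset.range q, T ((r + j) / q) := by
      rw [← sum_range_comp_mul_mod hMper hq hcopr (p * r), Finset.mul_sum, Finset.mul_sum,
        ← Finset.sum_add_distrib]
      refine Finset.sum_congr rfl fun j _ ↦ ?_
      rw [hMT ((r + j) / q), show (p : ℚ) * ((r + j) / q) = (p * r + p * j) / q by ring]
    rw [hsum, hMT (q * r), hMT r, show (p : ℚ) * (q * r) = q * (p * r) by ring]
    linear_combination c * hTH r
  have h0 := eq_zero_of_homogeneous (p := p) hHper hHrec hlam r
  simp only [hHdef] at h0
  exact sub_eq_zero.mp h0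

/-- **THE CONDUCTOR-`p` CASE: at a Kolyvagin prime `q` of `(W, p)` nothing is visible**
(`q ≡ 1 (mod p)` ⇒ `χ(q) = 1`, part 4b): `μ` plainly `T_q`-eigen with eigenvalue `a` ⇒ so is `M` —
the source-side Hecke datum `hH` of part 4b's conductor-`p` template read off the `W`-side one.
[cite: Shimura1971, Prop. 3.64] -/
theorem depletion_heckeRel_conductor (W : WeierstrassCurve ℚ) [W.IsGloballyMinimal]
    (hμ : IsPeriodic μ) (hMper : IsPeriodic M) {q : ℕ} (hq : Kato.IsKolyvaginPrime W p 1 q)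
    (hqp : q ≠ p) {a : R} (hH : HeckeRel μ q a)
    (hM : ∀ x : ℚ, M x = lam * M (p * x) + c * ∑ v : ZMod p, χ⁻¹ v * μ (x + (v.val : ℚ) / p))
    (hlam : ∀ n : ℕ, 0 < n → IsUnit (1 - lam ^ n)) : HeckeRel M q a := by
  intro r
  have hH' : ∀ s : ℚ, ∑ j ∈ Finset.range q, μ ((s + j) / q) + 1 * μ (q * s) = a * μ s :=
    fun s ↦ by rw [one_mul]; exact hH s
  have h := depletion_heckeRel_nebentypus χ hμ hMper hq.prime hqp hH' hM hlam r
  have h1 : χ (q : ZMod p) = 1 := by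
    have := map_natCast_eq_one_of_isKolyvaginPrime W p χ.toMonoidHom hq
    rwa [MulChar.coe_toMonoidHom] at this
  simpa only [h1, one_pow, one_mul, mul_one] using h

end Hecke

/-! ### §5 Transport of an `ℓ`-old congruence with its defect -/

section Transport

variable (χ : MulChar (ZMod p) R) {μ Λ D' M SΛ S' : ℚ → R} {lam c w π : R} {ℓ : ℕ}

/-- The twisted sum is additive: `T_{χ⁻¹}(D + π·D′) = T_{χ⁻¹}D + π·T_{χ⁻¹}D′`. [folklore] -/
private theorem twistSum_add_mul {D : ℚ → R}
    (hΛ : ∀ x : ℚ, Λ x = D x + π * D' x) (x : ℚ) :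
    ∑ v : ZMod p, χ⁻¹ v * Λ (x + (v.val : ℚ) / p) =
      ∑ v : ZMod p, χ⁻¹ v * D (x + (v.val : ℚ) / p) +
        π * ∑ v : ZMod p, χ⁻¹ v * D' (x + (v.val : ℚ) / p) := by
  simp_rw [hΛ, mul_add, Finset.sum_add_distrib, Finset.mul_sum]
  congr 1
  exact Finset.sum_congr rfl fun v _ ↦ by ring

/-- **TRANSPORT OF AN `ℓ`-OLD CONGRUENCE THROUGH THE RECURSION, WITH ITS DEFECT.** If
`Λ = μ − w·μ∘[ℓ] + π·D′` (`μ` periodic, `p ∤ ℓ`; `π·D′` = the DEFECT of the `W`-side congruence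
`Λ ≡ μ − wμ∘[ℓ] (mod π)`) and `S_Λ, M, S′` are periodic solutions of the recursion for
`c·T_{χ⁻¹}Λ, c·T_{χ⁻¹}μ, c·T_{χ⁻¹}D′` (same `λ`, every `1 − λⁿ` a unit), THEN
`S_Λ = M − (wχ(ℓ))·M∘[ℓ] + π·S′` EXACTLY. READING (file docstring): formal for the NON-PRIMITIVE
source symbol; the PRIMITIVE one `S_Λ/α` (`v_𝔭(α) = v_𝔭(p)`) needs `S′ ≡ 0 (mod 𝔭)`, NOT supplied
by the algebra. [cite: MazurTateTeitelbaum1986Invent, §I.8] -/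
theorem depletion_transport_defect (hμ : IsPeriodic μ) (hMper : IsPeriodic M)
    (hS'per : IsPeriodic S') (hSΛper : IsPeriodic SΛ) (hℓ : ¬ p ∣ ℓ)
    (hΛ : ∀ x : ℚ, Λ x = μ x - w * μ (ℓ * x) + π * D' x)
    (hM : ∀ x : ℚ, M x = lam * M (p * x) + c * ∑ v : ZMod p, χ⁻¹ v * μ (x + (v.val : ℚ) / p))
    (hS' : ∀ x : ℚ, S' x = lam * S' (p * x) + c * ∑ v : ZMod p, χ⁻¹ v * D' (x + (v.val : ℚ) / p))
    (hSΛ : ∀ x : ℚ, SΛ x = lam * SΛ (p * x) + c * ∑ v : ZMod p, χ⁻¹ v * Λ (x + (v.val : ℚ) / p))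
    (hlam : ∀ n : ℕ, 0 < n → IsUnit (1 - lam ^ n)) (x : ℚ) :
    SΛ x = M x - (w * χ ℓ) * M (ℓ * x) + π * S' x := by
  -- the candidate `M − (wχ(ℓ))M∘[ℓ] + π S′` is periodic and solves the recursion for `Λ`
  set D : ℚ → R := fun x ↦ μ x - w * μ (ℓ * x) with hDdef
  have hΛ' : ∀ x : ℚ, Λ x = D x + π * D' x := fun x ↦ by rw [hΛ x]
  have hper : IsPeriodic (fun x ↦ M x - (w * χ ℓ) * M (ℓ * x) + π * S' x) := by
    intro r z
    have h1 := isPeriodic_sub_mul_comp hMper (w * χ ℓ) ℓ r z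
    simp only at h1 ⊢
    rw [h1, hS'per r z]
  have hrec : ∀ x : ℚ, M x - (w * χ ℓ) * M (ℓ * x) + π * S' x =
      lam * (M (p * x) - (w * χ ℓ) * M (ℓ * (p * x)) + π * S' (p * x)) +
        c * ∑ v : ZMod p, χ⁻¹ v * Λ (x + (v.val : ℚ) / p) := by
    intro x
    have h1 := depletion_oldform χ hμ hℓ (fun x ↦ (rfl : D x = μ x - w * μ (ℓ * x))) hM x
    rw [twistSum_add_mul χ hΛ' x]
    linear_combination h1 + π * hS' x
  have h := depletion_unique (p := p) hSΛper hper hSΛ hrec hlam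
  exact congrFun h x

end Transport

end Summit.BirchSwinnertonDyer.Rank1Residual.NebentypusTwist

end
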